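import Summits.AtomisticToContinuum.HydrodynamicLimit.Theorems.JaynesSqueezeHardSphereLDADensityTools
import Summits.AtomisticToContinuum.HydrodynamicLimit.Theorems.JaynesSqueezeHardSphereLDAApprox
import Summits.AtomisticToContinuum.HydrodynamicLimit.Theorems.AntiMazurCoboundariesKineticWindowGronwallActivityInversion
import HarnessLib

/-!
# General-family mean empirical density from the free energies (convexity endgame)

Support file for the crux `…Theses.RelayRaceLocality.NearConstantShortTimeHL` (stmt-AtomisticToContinuum-12502),
line `means-pin-entropy`, stub `stub_ldaGeneralFamilies : GeneralFamilyLDA` (S1 (ii): the static mean of the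
log-profile needs the MEAN EMPIRICAL DENSITY of the canonical hard-sphere gas at the thermodynamic activity
`α_σ(ρ₁) = ρ₁ e^{g_σ(ρ₁)}` along a general family `(ε_N, n_N)`). The tree's law of large numbers
(`HardSphereEulerLLN`, `HardSphereLDA.tendsto_gibbsMean_thermoActivity`) is tied to the conjunct family
`(hsDiameter σ N, N + 1)`; means are not monotone in the diameter, so the diameter sandwich of
`…GeneralFamilyFreeEnergy` does not apply to them directly. Instead, this file derives the mean from the
FREE ENERGIES by convexity (the argument of item 13459's clause (B3), written for an arbitrary pair of sequences
`(ε_N, n_N)`, so that it serves the conjunct family as well):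

* `tendsto_gibbsMean_of_freeEnergy` — under the low-density equation of state (`f_ex = F` on `[0, η₀)`, `F`
  analytic: `HsEosLowDensity`) there is `η_B > 0` such that for `σ > 0`, a continuous unit-mass density
  `c ≤ ρ₁ ≤ R` with `Rσ³ ≤ η_B`, and sequences `(ε_N, n_N)` with `n_N ≥ 1` and positive free volume eventually:
  IF `n_N⁻¹ log Z(α_σ(ρ), ε_N, n_N) → V_σ(ρ) = ∫ ρ·ρσ³f_ex′(ρσ³)` for every continuous unit-mass `ρ` in the band
  `[c/2, R + c/2]`, THEN for every continuous `χ` the canonical Gibbs mean of `n_N⁻¹ ∑ χ(xᵢ)` at the activity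
  `α_σ(ρ₁)` tends to `∫ χ ρ₁`.
  Proof: perturb the DENSITY, `ρ_s = ρ₁ + s w` with `w = (χ − κ)/h_σ′(ρ₁)`, `κ` fixing `∫ w = 0`
  (`h_σ = log + g_σ`, `HardSphereLDA.eos_calculus`); then `α_σ(ρ_s) = α_σ(ρ₁) e^{ψ_s}` with
  `ψ_s ≥ s(χ − κ) − A s²` (Taylor), Jensen's bound `HardSphereLDA.gibbsMean_perturb_le` gives
  `s E_N ≤ Λ_N(s) − Λ_N(0) + sκ + A s²`, the free energies converge to `V_σ(ρ_s)` with
  `|V_σ(ρ_s) − V_σ(ρ₁) − s(∫χρ₁ − κ)| ≤ B s²` (`HardSphereLDA.integral_taylor_le`, `v_σ′ = r h_σ′ − 1`), and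
  `HardSphereLDA.tendsto_of_twoSided_perturbation` pins `E_N → ∫ χ ρ₁`.

No definitions. References: E. Pulvirenti – D. Tsagkarogiannis, Comm. Math. Phys. 316 (2012) Thm 2.1; H. Spohn,
*Large Scale Dynamics of Interacting Particles* (1991), Part I §2.3.
-/

noncomputable section

namespace Summit.AtomisticToContinuum.HydrodynamicLimit.Theorems.NearConstantShortTimeHL

open scoped BigOperators ENNReal Topology
open MeasureTheory Set Filter
open Literature.MathematicalPhysics.KineticTheory Literature.Analysis.FluidPDE Literature.Analysis.FunctionSpaces
open Summit.AtomisticToContinuum.HydrodynamicLimit.Theorems.HardSphereLDA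
open Summit.AtomisticToContinuum.HydrodynamicLimit.Theorems.KineticWindowGronwallActivityInversion

/-! ## Small tools -/

/-- `Z(m) = mⁿ Z(1)` for a constant activity. [folklore] -/
theorem posPartition_const (m ε : ℝ) (n : ℕ) :
    posPartition (fun _ => m) ε n = m ^ n * posPartition (fun _ => (1 : ℝ)) ε n := by
  rw [posPartition, posPartition, ← integral_const_mul]
  refine integral_congr_ae (Eventually.of_forall fun x => ?_)
  unfold posWeight
  by_cases hx : x ∈ posDomain ε n
  · simp only [indicator_of_mem hx, Finset.prod_const, Finset.card_univ, Fintype.card_fin, one_pow, mul_one]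
  · simp only [indicator_of_notMem hx, mul_zero]

/-- A measurable activity bounded below by `m > 0` has `Z(a) > 0` as soon as the free volume `Z(1)` is positive.
[folklore] -/
theorem posPartition_pos_of_le {a : T3 → ℝ} (ha : Measurable a) {m A : ℝ} (hm : 0 < m) (hma : ∀ y, m ≤ a y)
    (hA : ∀ y, a y ≤ A) {ε : ℝ} {n : ℕ} (hZ1 : 0 < posPartition (fun _ => (1 : ℝ)) ε n) :
    0 < posPartition a ε n := by
  have h1 : 0 < posPartition (fun _ => m) ε n := by
    rw [posPartition_const]; exact mul_pos (pow_pos hm n) hZ1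
  exact h1.trans_le (posPartition_mono ha (fun _ => hm.le) hma hA _ _)

/-- A function continuous at every point of a band is continuous along a continuous band-valued profile.
[folklore] -/
theorem continuous_comp_of_continuousAt {φ : ℝ → ℝ} {lo hi : ℝ} (hφ : ∀ r ∈ Icc lo hi, ContinuousAt φ r)
    {ρ : T3 → ℝ} (hρ : Continuous ρ) (hmem : ∀ x, ρ x ∈ Icc lo hi) : Continuous fun x => φ (ρ x) :=
  (continuousOn_of_forall_continuousAt hφ).comp_continuous hρ hmem

/-- The thermodynamic activity of a positive density is `e^{h_σ(ρ)}`, `h_σ = log + g_σ`. [folklore] -/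
theorem thermoActivity_eq_exp (σ : ℝ) {ρ : T3 → ℝ} (hρ0 : ∀ x, 0 < ρ x) (x : T3) :
    thermoActivity σ ρ x = Real.exp (Real.log (ρ x) +
      (hsExcessFreeEnergy (ρ x * σ ^ 3) + ρ x * σ ^ 3 * deriv hsExcessFreeEnergy (ρ x * σ ^ 3))) := by
  rw [thermoActivity]
  conv_rhs => rw [Real.exp_add, Real.exp_log (hρ0 x)]

/-! ## The mean empirical density from the free energies -/

/-- **MEAN EMPIRICAL DENSITY FROM THE FREE ENERGIES (general sequences).** Let `f_ex = F` on `[0, η₀)` with `F`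
analytic on `(−η₀, η₀)`. There is `η_B > 0` such that: for `σ > 0`, `0 < c`, a continuous density `ρ₁` with
`c ≤ ρ₁ ≤ R`, `Rσ³ ≤ η_B`, `∫ρ₁ = 1`, and ANY sequences `(ε_N, n_N)` with, eventually, `n_N ≥ 1` and positive free
volume `Z(1, ε_N, n_N) > 0` — if the free energies per particle at the thermodynamic activities of all continuous
unit-mass densities `ρ` of the band `[c/2, R + c/2]` converge to the local-density values,
`n_N⁻¹ log Z(α_σ(ρ), ε_N, n_N) → ∫ ρ·ρσ³f_ex′(ρσ³)`, then for every continuous `χ` the canonical Gibbs mean of the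
empirical density at the activity `α_σ(ρ₁)` converges: `Z⁻¹ ∫ 𝟙 ∏ α_σ(ρ₁)(xᵢ) · n_N⁻¹ ∑ χ(xᵢ) dx → ∫ χ ρ₁`.
[cite: PulvirentiTsagkarogiannis2012, Thm 2.1] -/
theorem tendsto_gibbsMean_of_freeEnergy {η₀ : ℝ} (hη₀ : 0 < η₀) {F : ℝ → ℝ}
    (hF : AnalyticOnNhd ℝ F (Ioo (-η₀) η₀)) (hEq : EqOn hsExcessFreeEnergy F (Ico 0 η₀)) :
    ∃ ηB : ℝ, 0 < ηB ∧ ∀ σ : ℝ, 0 < σ → ∀ c R : ℝ, 0 < c → ∀ ρ₁ : T3 → ℝ, Continuous ρ₁ →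
      (∀ x, c ≤ ρ₁ x ∧ ρ₁ x ≤ R) → R * σ ^ 3 ≤ ηB → (∫ x, ρ₁ x) = 1 →
      ∀ (ε : ℕ → ℝ) (n : ℕ → ℕ),
      (∀ᶠ N in atTop, 1 ≤ n N ∧ 0 < posPartition (fun _ => (1 : ℝ)) (ε N) (n N)) →
      (∀ ρ : T3 → ℝ, Continuous ρ → (∀ x, c / 2 ≤ ρ x ∧ ρ x ≤ R + c / 2) → (∫ x, ρ x) = 1 →
        Tendsto (fun N => (n N : ℝ)⁻¹ * Real.log (posPartition (thermoActivity σ ρ) (ε N) (n N))) atTop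
          (𝓝 (∫ x, ρ x * (ρ x * σ ^ 3 * deriv hsExcessFreeEnergy (ρ x * σ ^ 3))))) →
      ∀ χ : T3 → ℝ, Continuous χ →
        Tendsto (fun N => (posPartition (thermoActivity σ ρ₁) (ε N) (n N))⁻¹ *
          ∫ x, posWeight (thermoActivity σ ρ₁) (ε N) (n N) x * (((n N : ℕ) : ℝ)⁻¹ * ∑ i, χ (x i))) atTop
          (𝓝 (∫ x, χ x * ρ₁ x)) := by
  obtain ⟨ηc, hηc0, -, C, hC0, heos⟩ := eos_calculus hη₀ hF hEq
  refine ⟨ηc / 2, by positivity, ?_⟩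
  intro σ hσ c R hc ρ₁ hρ₁c hband hRσ hρ₁1 ε n hZ1 hB1 χ hχ
  obtain ⟨k, k₁, hkall⟩ := heos σ hσ
  have hσ3 : 0 < σ ^ 3 := pow_pos hσ 3
  have hcR : c ≤ R := (hband 0).1.trans (hband 0).2
  have hR0 : 0 < R := hc.trans_le hcR
  -- the band `[c/2, R + c/2]` is inside the calculus window
  set lo := c / 2 with hlo
  set hi := R + c / 2 with hhi
  have hlo0 : 0 < lo := by rw [hlo]; positivity
  have hband' : ∀ r ∈ Icc lo hi, 0 < r ∧ r * σ ^ 3 ≤ ηc := fun r hr => by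
    refine ⟨hlo0.trans_le hr.1, ?_⟩
    calc r * σ ^ 3 ≤ (R + c / 2) * σ ^ 3 := mul_le_mul_of_nonneg_right hr.2 hσ3.le
      _ ≤ (3 / 2) * (R * σ ^ 3) := by nlinarith
      _ ≤ (3 / 2) * (ηc / 2) := by gcongr
      _ ≤ ηc := by linarith
  have hρ₁mem : ∀ x, ρ₁ x ∈ Icc lo hi := fun x =>
    ⟨by rw [hlo]; linarith [(hband x).1], by rw [hhi]; linarith [(hband x).2]⟩
  -- notation for the calculus: `g_σ`, `h_σ = log + g_σ`, `v_σ`, `v₁ = r k − 1`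
  set g : ℝ → ℝ := fun r => hsExcessFreeEnergy (r * σ ^ 3) + r * σ ^ 3 * deriv hsExcessFreeEnergy (r * σ ^ 3)
    with hg
  set h : ℝ → ℝ := fun r => Real.log r + g r with hh
  set v : ℝ → ℝ := fun r => r * (r * σ ^ 3 * deriv hsExcessFreeEnergy (r * σ ^ 3)) with hv
  set v₁ : ℝ → ℝ := fun r => r * k r - 1 with hv₁
  have hcalc : ∀ r ∈ Icc lo hi, HasDerivAt h (k r) r ∧ 1 / (2 * r) ≤ k r ∧ k r ≤ 3 / (2 * r) ∧
      HasDerivAt k (k₁ r) r ∧ |k₁ r| ≤ 1 / r ^ 2 + C * σ ^ 6 ∧ HasDerivAt v (v₁ r) r ∧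
      HasDerivAt v₁ (deriv v₁ r) r ∧ |deriv v₁ r| ≤ C * σ ^ 3 := by
    intro r hr
    obtain ⟨-, -, h1, h2, h3, h4, h5, h6, d, h7, h8⟩ := hkall r (hband' r hr).1 (hband' r hr).2
    refine ⟨h1, h2, h3, h4, h5, h6, ?_, ?_⟩
    · rw [h7.deriv]; exact h7
    · rw [h7.deriv]; exact h8
  -- continuity along band-valued profiles
  have hkc : ∀ r ∈ Icc lo hi, ContinuousAt k r := fun r hr => (hcalc r hr).2.2.2.1.continuousAt
  have hhc : ∀ r ∈ Icc lo hi, ContinuousAt h r := fun r hr => (hcalc r hr).1.continuousAt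
  have hvc : ∀ r ∈ Icc lo hi, ContinuousAt v r := fun r hr => (hcalc r hr).2.2.2.2.2.1.continuousAt
  have hv₁c : ∀ r ∈ Icc lo hi, ContinuousAt v₁ r := fun r hr => (hcalc r hr).2.2.2.2.2.2.1.continuousAt
  have hkpos : ∀ r ∈ Icc lo hi, 0 < k r := fun r hr =>
    lt_of_lt_of_le (by have := (hband' r hr).1; positivity) (hcalc r hr).2.1
  -- the test function and the inverse slope `1/k(ρ₁)`
  obtain ⟨Cχ, -, hCχ⟩ := exists_forall_abs_le_of_continuous hχ
  have hCχ0 : 0 ≤ Cχ := (abs_nonneg _).trans (hCχ 0)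
  set ik : T3 → ℝ := fun x => 1 / k (ρ₁ x) with hik
  have hik_c : Continuous ik := by
    refine Continuous.div continuous_const (continuous_comp_of_continuousAt hkc hρ₁c hρ₁mem) fun x => ?_
    exact (hkpos _ (hρ₁mem x)).ne'
  have hik_bd : ∀ x, 2 * ρ₁ x / 3 ≤ ik x ∧ ik x ≤ 2 * ρ₁ x := by
    intro x
    obtain ⟨-, hk1, hk2, -⟩ := hcalc _ (hρ₁mem x)
    have hρ0 : 0 < ρ₁ x := hc.trans_le (hband x).1
    have hk0 := hkpos _ (hρ₁mem x)
    simp only [hik]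
    constructor
    · rw [div_le_div_iff₀ (by norm_num) hk0]
      have := mul_le_mul_of_nonneg_left hk2 (show (0 : ℝ) ≤ 2 * ρ₁ x by positivity)
      rw [show 2 * ρ₁ x * (3 / (2 * ρ₁ x)) = 3 by field_simp] at this
      linarith
    · rw [div_le_iff₀ hk0]
      have := mul_le_mul_of_nonneg_left hk1 (show (0 : ℝ) ≤ 2 * ρ₁ x by positivity)
      rw [show 2 * ρ₁ x * (1 / (2 * ρ₁ x)) = 1 by field_simp] at this
      linarith
  have hik_pos : ∀ x, 0 < ik x := fun x =>
    lt_of_lt_of_le (by have := hc.trans_le (hband x).1; positivity) (hik_bd x).1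
  have hik_le : ∀ x, ik x ≤ 2 * R := fun x => (hik_bd x).2.trans (by linarith [(hband x).2])
  -- `κ` fixes the mass of the perturbation
  set I₀ : ℝ := ∫ x, ik x with hI₀
  have hI₀pos : 0 < I₀ := by
    have h1 : (∫ _ : T3, 2 * c / 3) ≤ I₀ := integral_mono (integrable_const _) (integrable_of_continuous_T3 hik_c)
      fun x => le_trans (by linarith [(hband x).1]) (hik_bd x).1
    rw [integral_const, smul_eq_mul, probReal_univ, one_mul] at h1
    linarith
  set κ : ℝ := (∫ x, χ x * ik x) / I₀ with hκ
  have hκ_bd : |κ| ≤ Cχ := by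
    rw [hκ, abs_div, abs_of_pos hI₀pos, div_le_iff₀ hI₀pos]
    calc |∫ x, χ x * ik x| ≤ ∫ x, |χ x * ik x| := abs_integral_le_integral_abs
      _ ≤ ∫ x, Cχ * ik x := integral_mono (integrable_of_continuous_T3 (hχ.mul hik_c)).abs
          ((integrable_of_continuous_T3 hik_c).const_mul _) fun x => by
            rw [abs_mul, abs_of_pos (hik_pos x)]
            exact mul_le_mul_of_nonneg_right (hCχ x) (hik_pos x).le
      _ = Cχ * I₀ := integral_const_mul _ _
  -- the perturbation `w = (χ − κ)/k(ρ₁)`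
  set w : T3 → ℝ := fun x => (χ x - κ) * ik x with hw
  have hw_c : Continuous w := (hχ.sub continuous_const).mul hik_c
  set Wb : ℝ := 2 * Cχ * (2 * R) with hWb
  have hWb0 : 0 ≤ Wb := by positivity
  have hw_bd : ∀ x, |w x| ≤ Wb := fun x => by
    simp only [hw, hWb]
    rw [abs_mul, abs_of_pos (hik_pos x)]
    refine mul_le_mul ?_ (hik_le x) (hik_pos x).le (by positivity)
    calc |χ x - κ| ≤ |χ x| + |κ| := abs_sub _ _
      _ ≤ Cχ + Cχ := add_le_add (hCχ x) hκ_bd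
      _ = 2 * Cχ := by ring
  have hw_int : ∫ x, w x = 0 := by
    have hA : Integrable fun x => χ x * ik x := integrable_of_continuous_T3 (hχ.mul hik_c)
    have hB : Integrable fun x => κ * ik x := (integrable_of_continuous_T3 hik_c).const_mul κ
    have e1 : ∫ x, w x = (∫ x, χ x * ik x) - κ * ∫ x, ik x := by
      rw [← integral_const_mul, ← integral_sub hA hB]
      refine integral_congr_ae (Eventually.of_forall fun x => ?_)
      simp only [hw]; ring
    rw [e1, hκ, div_mul_cancel₀ _ hI₀pos.ne', sub_self]
  -- the perturbed densities `ρ_s = ρ₁ + s w`, `|s| ≤ s₀`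
  set s₀ : ℝ := c / (2 * (Wb + 1)) with hs₀
  have hs₀pos : 0 < s₀ := by positivity
  have hsw : ∀ s : ℝ, |s| ≤ s₀ → ∀ x, |s * w x| ≤ c / 2 := by
    intro s hs x
    rw [abs_mul]
    calc |s| * |w x| ≤ s₀ * Wb := mul_le_mul hs (hw_bd x) (abs_nonneg _) hs₀pos.le
      _ = c / 2 * (Wb / (Wb + 1)) := by rw [hs₀]; field_simp
      _ ≤ c / 2 * 1 := by gcongr; rw [div_le_one (by positivity)]; linarith
      _ = c / 2 := mul_one _
  have hρs_mem : ∀ s : ℝ, |s| ≤ s₀ → ∀ x, ρ₁ x + s * w x ∈ Icc lo hi := by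
    intro s hs x
    have h1 := abs_le.1 (hsw s hs x)
    exact ⟨by rw [hlo]; linarith [(hband x).1], by rw [hhi]; linarith [(hband x).2]⟩
  have hρs_band : ∀ s : ℝ, |s| ≤ s₀ → ∀ x, c / 2 ≤ ρ₁ x + s * w x ∧ ρ₁ x + s * w x ≤ R + c / 2 :=
    fun s hs x => hρs_mem s hs x
  have hρs_c : ∀ s : ℝ, Continuous fun x => ρ₁ x + s * w x := fun s => hρ₁c.add (continuous_const.mul hw_c)
  have hρs_1 : ∀ s : ℝ, (∫ x, ρ₁ x + s * w x) = 1 := fun s => by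
    rw [integral_add (integrable_of_continuous_T3 hρ₁c) ((integrable_of_continuous_T3 hw_c).const_mul s),
      integral_const_mul, hw_int, hρ₁1]; ring
  have hρs_pos : ∀ s : ℝ, |s| ≤ s₀ → ∀ x, 0 < ρ₁ x + s * w x := fun s hs x =>
    hlo0.trans_le (hρs_mem s hs x).1
  -- the activity `α_σ(ρ₁)`, its bounds
  have hρ₁pos : ∀ x, 0 < ρ₁ x := fun x => hc.trans_le (hband x).1
  have hhρ_c : ∀ s : ℝ, |s| ≤ s₀ → Continuous fun x => h (ρ₁ x + s * w x) := fun s hs =>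
    continuous_comp_of_continuousAt hhc (hρs_c s) (hρs_mem s hs)
  have h0abs : |(0 : ℝ)| ≤ s₀ := by rw [abs_zero]; exact hs₀pos.le
  have hh₁_c : Continuous fun x => h (ρ₁ x) := by
    have := hhρ_c 0 h0abs; simpa using this
  have hact_eq : ∀ s : ℝ, |s| ≤ s₀ →
      thermoActivity σ (fun x => ρ₁ x + s * w x) = fun x => Real.exp (h (ρ₁ x + s * w x)) := fun s hs =>
    funext fun x => thermoActivity_eq_exp σ (hρs_pos s hs) x
  have ha_eq : thermoActivity σ ρ₁ = fun x => Real.exp (h (ρ₁ x)) := funext fun x => thermoActivity_eq_exp σ hρ₁pos x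
  have ha_c : Continuous (thermoActivity σ ρ₁) := by rw [ha_eq]; exact Real.continuous_exp.comp hh₁_c
  obtain ⟨Bh, -, hBh⟩ := exists_forall_abs_le_of_continuous hh₁_c
  have ha_lo : ∀ x, Real.exp (-Bh) ≤ thermoActivity σ ρ₁ x := fun x => by
    rw [ha_eq]; exact Real.exp_le_exp.2 (abs_le.1 (hBh x)).1
  have ha_hi : ∀ x, thermoActivity σ ρ₁ x ≤ Real.exp Bh := fun x => by
    rw [ha_eq]; exact Real.exp_le_exp.2 (abs_le.1 (hBh x)).2
  have ha_pos : ∀ x, 0 < thermoActivity σ ρ₁ x := fun x => (Real.exp_pos _).trans_le (ha_lo x)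
  -- the tilts `ψ_s = h(ρ_s) − h(ρ₁)` and their Taylor control
  set K₂ : ℝ := 1 / lo ^ 2 + C * σ ^ 6 with hK₂
  have hK₂0 : 0 ≤ K₂ := by positivity
  have htaylor : ∀ s : ℝ, |s| ≤ s₀ → ∀ x,
      |h (ρ₁ x + s * w x) - h (ρ₁ x) - k (ρ₁ x) * (s * w x)| ≤ K₂ * (s * w x) ^ 2 := by
    intro s hs x
    have hseg : uIcc (ρ₁ x) (ρ₁ x + s * w x) ⊆ Icc lo hi := uIcc_subset_Icc (hρ₁mem x) (hρs_mem s hs x)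
    have h1 := abs_sub_sub_mul_le_of_deriv (f := h) (f₁ := k) (f₂ := k₁) (K := K₂) (x := ρ₁ x)
      (y := ρ₁ x + s * w x) (fun t ht => (hcalc t (hseg ht)).1) (fun t ht => (hcalc t (hseg ht)).2.2.2.1)
      (fun t ht => ?_)
    · rwa [show ρ₁ x + s * w x - ρ₁ x = s * w x by ring] at h1
    · have ht' := hseg ht
      refine (hcalc t ht').2.2.2.2.1.trans ?_
      simp only [hK₂]
      gcongr
      exact ht'.1
  have hkw : ∀ s : ℝ, ∀ x, k (ρ₁ x) * (s * w x) = s * (χ x - κ) := fun s x => by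
    simp only [hw, hik]
    field_simp [(hkpos _ (hρ₁mem x)).ne']
  have hdom : ∀ s : ℝ, |s| ≤ s₀ → ∀ x,
      s * (χ x - κ) - K₂ * Wb ^ 2 * s ^ 2 ≤ h (ρ₁ x + s * w x) - h (ρ₁ x) := by
    intro s hs x
    have h1 := (abs_le.1 (htaylor s hs x)).1
    rw [hkw] at h1
    have hsq : (s * w x) ^ 2 ≤ Wb ^ 2 * s ^ 2 := by
      rw [mul_pow, mul_comm]
      exact mul_le_mul_of_nonneg_right (by rw [← sq_abs]; exact pow_le_pow_left₀ (abs_nonneg _) (hw_bd x) 2)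
        (sq_nonneg _)
    nlinarith [mul_le_mul_of_nonneg_left hsq hK₂0]
  have hψ_bd : ∀ s : ℝ, |s| ≤ s₀ → ∀ x,
      |h (ρ₁ x + s * w x) - h (ρ₁ x)| ≤ s₀ * (2 * Cχ) + K₂ * Wb ^ 2 * s₀ ^ 2 := by
    intro s hs x
    have h1 := htaylor s hs x
    rw [hkw] at h1
    have hsq : (s * w x) ^ 2 ≤ Wb ^ 2 * s₀ ^ 2 := by
      rw [mul_pow]
      calc s ^ 2 * w x ^ 2 ≤ s₀ ^ 2 * Wb ^ 2 := mul_le_mul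
            (by rw [← sq_abs]; exact pow_le_pow_left₀ (abs_nonneg _) hs 2)
            (by rw [← sq_abs]; exact pow_le_pow_left₀ (abs_nonneg _) (hw_bd x) 2) (sq_nonneg _) (sq_nonneg _)
        _ = Wb ^ 2 * s₀ ^ 2 := by ring
    have h2 : |s * (χ x - κ)| ≤ s₀ * (2 * Cχ) := by
      rw [abs_mul]
      refine mul_le_mul hs ?_ (abs_nonneg _) hs₀pos.le
      calc |χ x - κ| ≤ |χ x| + |κ| := abs_sub _ _
        _ ≤ Cχ + Cχ := add_le_add (hCχ x) hκ_bd
        _ = 2 * Cχ := by ring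
    calc |h (ρ₁ x + s * w x) - h (ρ₁ x)|
        = |(h (ρ₁ x + s * w x) - h (ρ₁ x) - s * (χ x - κ)) + s * (χ x - κ)| := by ring_nf
      _ ≤ |h (ρ₁ x + s * w x) - h (ρ₁ x) - s * (χ x - κ)| + |s * (χ x - κ)| := abs_add_le _ _
      _ ≤ K₂ * (s * w x) ^ 2 + s₀ * (2 * Cχ) := add_le_add h1 h2
      _ ≤ K₂ * (Wb ^ 2 * s₀ ^ 2) + s₀ * (2 * Cχ) := by gcongr
      _ = s₀ * (2 * Cχ) + K₂ * Wb ^ 2 * s₀ ^ 2 := by ring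
  -- eventually: `n_N ≥ 1` and all partition functions are positive
  obtain ⟨N₀, hN₀⟩ := eventually_atTop.1 hZ1
  have hZa : ∀ N, N₀ ≤ N → 0 < posPartition (thermoActivity σ ρ₁) (ε N) (n N) := fun N hN =>
    posPartition_pos_of_le ha_c.measurable (Real.exp_pos _) ha_lo ha_hi (hN₀ N hN).2
  -- the sequences of the endgame, shifted by `N₀`
  set EN : ℕ → ℝ := fun N => (posPartition (thermoActivity σ ρ₁) (ε (N + N₀)) (n (N + N₀)))⁻¹ *
    ∫ x, posWeight (thermoActivity σ ρ₁) (ε (N + N₀)) (n (N + N₀)) x *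
      (((n (N + N₀) : ℕ) : ℝ)⁻¹ * ∑ i, χ (x i)) with hEN
  set Λ : ℝ → ℕ → ℝ := fun s N => ((n (N + N₀) : ℕ) : ℝ)⁻¹ *
    Real.log (posPartition (thermoActivity σ (fun x => ρ₁ x + s * w x)) (ε (N + N₀)) (n (N + N₀))) with hΛ
  set V : ℝ → ℝ := fun s => ∫ x, v (ρ₁ x + s * w x) with hV
  set J : ℝ := ∫ x, χ x * ρ₁ x with hJ
  have hρ0w : (fun x => ρ₁ x + 0 * w x) = ρ₁ := by funext x; ring
  -- (1) the perturbation inequalities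
  have hstar : ∀ s : ℝ, |s| ≤ s₀ → ∀ N : ℕ, s * EN N ≤ Λ s N - Λ 0 N + s * κ + K₂ * Wb ^ 2 * s ^ 2 := by
    intro s hs N
    have hM₀ : N₀ ≤ N + N₀ := Nat.le_add_left _ _
    have hnM : 0 < n (N + N₀) := (hN₀ (N + N₀) hM₀).1
    have hψm : Measurable fun x => h (ρ₁ x + s * w x) - h (ρ₁ x) := ((hhρ_c s hs).sub hh₁_c).measurable
    have hpert := gibbsMean_perturb_le (a := thermoActivity σ ρ₁) (n := n (N + N₀)) ha_c.measurable
      (fun y => (ha_pos y).le) ha_hi (ε (N + N₀)) hnM (hZa (N + N₀) hM₀)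
      (ψ := fun x => h (ρ₁ x + s * w x) - h (ρ₁ x))
      (χ := χ) hψm (hψ_bd s hs) hχ.measurable hCχ (s := s) (κ := κ) (T := K₂ * Wb ^ 2 * s ^ 2) (by positivity)
      (hdom s hs)
    have htilt : (fun y => thermoActivity σ ρ₁ y * Real.exp (h (ρ₁ y + s * w y) - h (ρ₁ y))) =
        thermoActivity σ (fun x => ρ₁ x + s * w x) := by
      rw [hact_eq s hs, ha_eq]
      funext y
      rw [← Real.exp_add, add_sub_cancel]
    rw [htilt] at hpert
    have hΛ0 : Λ 0 N = ((n (N + N₀) : ℕ) : ℝ)⁻¹ *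
        Real.log (posPartition (thermoActivity σ ρ₁) (ε (N + N₀)) (n (N + N₀))) := by
      simp only [hΛ, hρ0w]
    have hΛs : Λ s N = ((n (N + N₀) : ℕ) : ℝ)⁻¹ *
        Real.log (posPartition (thermoActivity σ (fun x => ρ₁ x + s * w x)) (ε (N + N₀)) (n (N + N₀))) := by
      simp only [hΛ]
    rw [hΛ0, hΛs, ← mul_sub]
    exact hpert
  -- (2) the free energies of the perturbed densities converge
  have hlim : ∀ s : ℝ, |s| ≤ s₀ → Tendsto (Λ s) atTop (𝓝 (V s)) := by
    intro s hs
    have h1 := hB1 (fun x => ρ₁ x + s * w x) (hρs_c s) (hρs_band s hs) (hρs_1 s)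
    exact (tendsto_add_atTop_iff_nat N₀).2 h1
  -- (3) second-order expansion of the limit
  have hVtaylor : ∀ s : ℝ, |s| ≤ s₀ → |V s - V 0 - s * (J - κ)| ≤ C * σ ^ 3 * Wb ^ 2 * s ^ 2 := by
    intro s hs
    have hvi : ∀ t : ℝ, |t| ≤ s₀ → Integrable fun x => v (ρ₁ x + t * w x) := fun t ht =>
      integrable_of_continuous_T3 (continuous_comp_of_continuousAt hvc (hρs_c t) (hρs_mem t ht))
    have hv₁i : Integrable fun x => v₁ (ρ₁ x) * (s * w x) :=
      integrable_of_continuous_T3 ((continuous_comp_of_continuousAt hv₁c hρ₁c hρ₁mem).mul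
        (continuous_const.mul hw_c))
    have h1 := integral_taylor_le (v := v) (v₁ := v₁) (lo := lo) (hi := hi) (K := C * σ ^ 3) (W := Wb) (s := s)
      (fun t ht => (hcalc t ht).2.2.2.2.2.1) (fun t ht => (hcalc t ht).2.2.2.2.2.2.1)
      (fun t ht => (hcalc t ht).2.2.2.2.2.2.2) (by positivity) hρ₁mem (hρs_mem s hs) hw_bd (hvi s hs)
      (by have := hvi 0 h0abs; simpa using this) hv₁i
    -- the first-order term is `s (J − κ)`
    have hlin : ∫ x, v₁ (ρ₁ x) * (s * w x) = s * (J - κ) := by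
      have hpt : ∀ x, v₁ (ρ₁ x) * (s * w x) = s * (χ x * ρ₁ x - κ * ρ₁ x - w x) := by
        intro x
        have hkt : k (ρ₁ x) * (1 / k (ρ₁ x)) = 1 := mul_one_div_cancel (hkpos _ (hρ₁mem x)).ne'
        simp only [hv₁, hw, hik]
        linear_combination (s * (χ x - κ) * ρ₁ x) * hkt
      simp_rw [hpt]
      rw [integral_const_mul, integral_sub, integral_sub, integral_const_mul, hw_int, hρ₁1, ← hJ]
      · ring
      · exact integrable_of_continuous_T3 (hχ.mul hρ₁c)
      · exact (integrable_of_continuous_T3 hρ₁c).const_mul κ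
      · exact (integrable_of_continuous_T3 (hχ.mul hρ₁c)).sub ((integrable_of_continuous_T3 hρ₁c).const_mul κ)
      · exact integrable_of_continuous_T3 hw_c
    have hV0 : V 0 = ∫ x, v (ρ₁ x) := by simp [hV]
    rw [hV0, ← hlin]
    exact h1
  -- (4) the endgame, then undo the shift
  have hmain := tendsto_of_twoSided_perturbation (EN := EN) (Λ := Λ) (V := V) (J := J) (κ := κ)
    (A := K₂ * Wb ^ 2) (B := C * σ ^ 3 * Wb ^ 2) hs₀pos (by positivity) (by positivity) hstar hlim hVtaylor
  exact (tendsto_add_atTop_iff_nat N₀).1 hmain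

/-- **MEAN EMPIRICAL DENSITY FROM THE FREE ENERGIES, registered form** (helper stub `generalFamilyMeanDensity` of crux
stmt-AtomisticToContinuum-12502, line `means-pin-entropy`; the statement of `tendsto_gibbsMean_of_freeEnergy` as one
closed proposition). [cite: PulvirentiTsagkarogiannis2012, Thm 2.1] -/
theorem generalFamilyMeanDensity : ∀ {η₀ : ℝ}, 0 < η₀ → ∀ {F : ℝ → ℝ}, AnalyticOnNhd ℝ F (Set.Ioo (-η₀) η₀) → Set.EqOn hsExcessFreeEnergy F (Set.Ico 0 η₀) → ∃ ηB : ℝ, 0 < ηB ∧ ∀ σ : ℝ, 0 < σ → ∀ c R : ℝ, 0 < c → ∀ ρ₁ : T3 → ℝ, Continuous ρ₁ → (∀ x, c ≤ ρ₁ x ∧ ρ₁ x ≤ R) → R * σ ^ 3 ≤ ηB → (∫ x, ρ₁ x) = 1 → ∀ (ε : ℕ → ℝ) (n : ℕ → ℕ), (∀ᶠ N in Filter.atTop, 1 ≤ n N ∧ 0 < posPartition (fun _ => (1 : ℝ)) (ε N) (n N)) → (∀ ρ : T3 → ℝ, Continuous ρ → (∀ x, c / 2 ≤ ρ x ∧ ρ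 x ≤ R + c / 2) → (∫ x, ρ x) = 1 → Filter.Tendsto (fun N => (n N : ℝ)⁻¹ * Real.log (posPartition (thermoActivity σ ρ) (ε N) (n N))) Filter.atTop (nhds (∫ x, ρ x * (ρ x * σ ^ 3 * deriv hsExcessFreeEnergy (ρ x * σ ^ 3))))) → ∀ χ : T3 → ℝ, Continuous χ → Filter.Tendsto (fun N => (posPartition (thermoActivity σ ρ₁) (ε N) (n N))⁻¹ * ∫ x, posWeight (thermoActivity σ ρ₁) (ε N) (n N) x * (((n N : ℕ) : ℝ)⁻¹ * ∑ i, χ (x i))) Filter.atTop (nhds (∫ x, χ x * ρ₁ x)) :=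
  fun hη₀ _ hF hEq => tendsto_gibbsMean_of_freeEnergy hη₀ hF hEq

end Summit.AtomisticToContinuum.HydrodynamicLimit.Theorems.NearConstantShortTimeHL

end
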